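import Summits.QuantumFields.BalabanUV.Beta.D1BFx.PeriodicArrays
import Summits.QuantumFields.BalabanUV.Beta.D1BFx.TorusCombKKT
import Summits.QuantumFields.BalabanUV.Beta.D1BFx.SortedEmbeddingWall

/-!
# `BalabanUV.Beta.D1BFx.SortedKKTShape` — road «BF-x» for binder row D1, slot (K), chain step (I) «(A1)-PACKED», brick «KKT-SHAPE»
# (`A1-PACKED-SPEC.md` v0.3.1 §8): **THE PERIODISED SORTED ARRAY OF A KERNEL WITH NO MULTIPLIER–MULTIPLIER BLOCK IS `kkt`-SHAPED** —
# `blocksHat p (sortK n W) = kkt (ff̂) (m̂f)` when the fm block is the kernel-transpose of the mf block, and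
# `blocksHat p (sortK n W) = kkt (ff̂) (m̂f) · diag(1, −1)` when it is MINUS the transpose (the F-g6-1 placement of the second-order tables);
# plus the parity read-outs `(ff̂)ᵀ = ± ff̂` of a kernel-(anti)symmetric ff block.

HONEST DEPENDENCY (cell records, verbatim): «continuum YM on T⁴ ⇐ BetaPertH ∧ nine spine estimates (0/9 proved); BetaPertH ⇐ (D1) ∧ (D4) ∧
CAP+tail; G-an2-4 gates asym, D1 and NE2/3/4.»  HONEST FRAMING (cell contract, verbatim): «discharging `BetaPertH` makes Bałaban's UV stability
UNCONDITIONAL — a real constructive-QFT result; it is NOT the continuum limit and NOT the Clay problem.»  THIS MODULE DISCHARGES NOTHING of (K),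
of D1 or of the wall: [folklore] block bookkeeping over TA1 (`SortedKernels.blocksHat`, `fTL ∕ fTR ∕ fBL ∕ fBR`, `periodiseF_trF`, `periodiseF_zero`),
`SortedPack.sortK`, `SortedEmbeddingWall.periodiseF_neg'` and the model's `Composition.kkt`, exactly as `TorusCombKKT.blocksHat_sortK_bhK` does it for `bhK`.  No definition, no
`def … : Prop`, nothing cited, 0 sorry.  0 root-level binders of row D1 discharged; (K) NOT closed; NOT D1, NOT `BetaPertH`, NOT continuum, NOT Clay.

ABSOLUTE RULE (cell charter, verbatim): «No internally-minted statement may enter as a cited fact. Every hypothesis is either kernel-proved in this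
package or a verbatim quotation of a PUBLISHED theorem with page reference. The manuscript(s) under audit are NOT citable for their own disputed
steps — they are the thing under adjudication; programme-internal (2001/route/tribunal) claims are never citable.»

WHY (owner d1-p2 gen 17, `A1-PACKED-SPEC.md` §8 «KKT-SHAPE»).  (B3) «A1-PACKED-TORUS» feeds `KCombineCovColourTorus.identity_array_currency_cov_What0_stripped`,
whose M-side data are MATRICES `kₛ qₛ` (first order), `kₛₜ qₛₜ` (second order) with the dictionary letters `hJM : kkt kₛ qₛ = (arr s 𝒱)ˆ`,
`hJM″ : kkt kₛₜ qₛₜ · fromBlocks 1 0 0 (−1) = (arr s 𝒲)ˆ` (`ˆ := blocksHat p ∘ sortK n`) and the parity letters `kₛᵀ = −kₛ`, `kₛₜᵀ = kₛₜ`.  For RESPONSE-PACKED data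
the per-bond tables ARE `(arr s (S κ u))ˆ`; THIS FILE says when such a periodised sorted kernel IS `kkt (ff̂) (m̂f)` (resp. `· diag(1,−1)`) — two STRUCTURAL
sockets on the `ℤ^D` kernel `W`: NO mm BLOCK (`W x y (inr ·) (inr ·) = 0`) and fm∕mf KERNEL (ANTI)SYMMETRY (`W x y (inl a) (inr b) = ± W y x (inr b) (inl a)`) —
and reads the parity of `ff̂` from the ff kernel (anti)symmetry; joint `(n·p)`-periodicity of `W` (automatic for `W = arr (n·p) V`, §1) carries the transpose
through the periodisation.  So (B3) defines `kₛ := ff̂`, `qₛ := m̂f` of the packed tables and gets `hJM•`∕`hk•` from the literal's displayed structural sockets.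

CONTENT (all [folklore]; generic `D`, fibre sort `F`).
* §1 `isPeriodic₂_sortK_of_imageShift` (joint `(n·p)`-periodicity of `W` ⇒ jointly `p`-periodic sorted fibres), `isPeriodic₂_sortK_arr` (the array case).
* §2 `fTR_sortK_eq_trF` ∕ `fTR_sortK_eq_neg_trF`, `fBR_sortK_eq_zero`, **`blocksHat_sortK_eq_kkt`**, **`blocksHat_sortK_eq_kkt_mul_sgn`**.
* §3 `transpose_ffHat_eq` ∕ `transpose_ffHat_eq_neg` (parity read-outs of `ff̂ := Matrix.of (periodiseF p (fTL (sortK n W)))`).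
Unit `b2b-balaban-beta-d1-p2` (road owner, gen 17), 2026-08-22.
-/

noncomputable section

namespace Summit.QuantumFields.BalabanUV.Beta.D1BFx.SortedKKTShape

open Matrix
open scoped BigOperators
open Literature.Probability.LatticeModels (TorusSite)
open Literature.MathematicalPhysics.QuantumFieldTheory.Balaban1983to89
open Literature.MathematicalPhysics.QuantumFieldTheory.Balaban1983to89.Beta
open Literature.MathematicalPhysics.QuantumFieldTheory.Balaban1983to89.Beta.Composition (kkt)
open ExpKernelCalculus (MKer)
open Summit.QuantumFields.BalabanUV.Beta.D1BFx.FibredPeriodisation (FKer periodiseF periodiseF_apply Kfib Kfib_apply)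
open Summit.QuantumFields.BalabanUV.Beta.D1BFx.SortedKernels (blocksHat fTL fTR fBL fBR trF trF_apply periodiseF_trF periodiseF_trF_apply periodiseF_zero)
open Summit.QuantumFields.BalabanUV.Beta.D1BFx.SortedReblocking (finePt finePt_imageShift)
open Summit.QuantumFields.BalabanUV.Beta.D1BFx.SortedPack (sortK sortK_inl_inl sortK_inl_inr sortK_inr_inl sortK_inr_inr)
open Summit.QuantumFields.BalabanUV.Beta.D1BFx.PeriodicArrays (arr arr_imageShift)
open Summit.QuantumFields.BalabanUV.Beta.D1BFx.SortedEmbeddingWall (periodiseF_neg')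

variable {D : ℕ} {F : Type*} {n p : ℕ}

/-! ## §1 Joint period-periodicity of the kernel gives jointly periodic sorted fibres -/

section Periodic

/-- [folklore] If `W` is jointly `(n·p)`-periodic (`W (x + (n·p)·t) (y + (n·p)·t) = W x y`), every fibre of `sortK n W` is jointly `p`-periodic on the
coarse lattice (fine points of coarse images are fine images: `finePt_imageShift`, `n • (w + p·t) = n•w + (n·p)·t`). -/
theorem isPeriodic₂_sortK_of_imageShift {W : MKer D (F ⊕ F)}
    (hW : ∀ (x y t : Fin D → ℤ) (a b : F ⊕ F), W (imageShift (n * p) x t) (imageShift (n * p) y t) a b = W x y a b) :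
    ∀ i j, IsPeriodic₂ p (Kfib (sortK n W) i j) := by
  have hz : ∀ w t : Fin D → ℤ, (n : ℤ) • imageShift p w t = imageShift (n * p) ((n : ℤ) • w) t := fun w t => by
    funext i; simp only [Pi.smul_apply, imageShift, smul_eq_mul, Nat.cast_mul]; ring
  rintro (⟨z, a⟩ | a) (⟨z', b⟩ | b) y y' t
  · simp only [Kfib_apply, sortK_inl_inl, finePt_imageShift]; exact hW _ _ _ _ _
  · simp only [Kfib_apply, sortK_inl_inr, finePt_imageShift, hz]; exact hW _ _ _ _ _
  · simp only [Kfib_apply, sortK_inr_inl, finePt_imageShift, hz]; exact hW _ _ _ _ _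
  · simp only [Kfib_apply, sortK_inr_inr, hz]; exact hW _ _ _ _ _

/-- [folklore] In particular for an ARRAY `W = arr (n·p) V` (`PeriodicArrays.arr_imageShift`). -/
theorem isPeriodic₂_sortK_arr (V : MKer D (F ⊕ F)) : ∀ i j, IsPeriodic₂ p (Kfib (sortK n (arr (n * p) V)) i j) :=
  isPeriodic₂_sortK_of_imageShift fun x y t a b => arr_imageShift (n * p) V x y t a b

end Periodic

/-! ## §2 The `kkt` shapes -/

section Shape

variable {W : MKer D (F ⊕ F)}

/-- [folklore] fm∕mf KERNEL SYMMETRY in sorted form: `fTR (sortK n W) = trF (fBL (sortK n W))`. -/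
theorem fTR_sortK_eq_trF (hfm : ∀ (x y : Fin D → ℤ) (a b : F), W x y (Sum.inl a) (Sum.inr b) = W y x (Sum.inr b) (Sum.inl a)) :
    fTR (sortK n W) = trF (fBL (sortK n W)) := by
  funext ⟨y, z, a⟩ ⟨y', b⟩
  rw [trF_apply]
  show sortK n W (y, Sum.inl (z, a)) (y', Sum.inr b) = sortK n W (y', Sum.inr b) (y, Sum.inl (z, a))
  rw [sortK_inl_inr, sortK_inr_inl]
  exact hfm _ _ _ _

/-- [folklore] fm∕mf KERNEL ANTISYMMETRY in sorted form: `fTR (sortK n W) = −trF (fBL (sortK n W))` (the `bhK` ∕ second-order-table placement). -/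
theorem fTR_sortK_eq_neg_trF (hfm : ∀ (x y : Fin D → ℤ) (a b : F), W x y (Sum.inl a) (Sum.inr b) = -W y x (Sum.inr b) (Sum.inl a)) :
    fTR (sortK n W) = fun i j => -(trF (fBL (sortK n W)) i j) := by
  funext ⟨y, z, a⟩ ⟨y', b⟩
  rw [trF_apply]
  show sortK n W (y, Sum.inl (z, a)) (y', Sum.inr b) = -(sortK n W (y', Sum.inr b) (y, Sum.inl (z, a)))
  rw [sortK_inl_inr, sortK_inr_inl]
  exact hfm _ _ _ _

/-- [folklore] NO mm BLOCK in sorted form: `fBR (sortK n W) = 0`. -/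
theorem fBR_sortK_eq_zero (hmm : ∀ (x y : Fin D → ℤ) (a b : F), W x y (Sum.inr a) (Sum.inr b) = 0) :
    fBR (sortK n W) = fun _ _ => (0 : ℝ) := by
  funext ⟨y, a⟩ ⟨y', b⟩
  show sortK n W (y, Sum.inr a) (y', Sum.inr b) = 0
  rw [sortK_inr_inr]
  exact hmm _ _ _ _

variable [NeZero p]

/-- [folklore] **«KKT-SHAPE», PLAIN**: for a kernel `W` with jointly `p`-periodic sorted fibres (§1), NO mm block and fm = kernel-transpose of mf,
`blocksHat p (sortK n W) = kkt (Matrix.of (periodiseF p (fTL (sortK n W)))) (Matrix.of (periodiseF p (fBL (sortK n W))))`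
— the shape of the FIRST-order dictionary letters `hJM`, `hJM′` of `KCombineCovStripped.hessKer_transfer_road_cov_stripped`. -/
theorem blocksHat_sortK_eq_kkt (hper : ∀ i j, IsPeriodic₂ p (Kfib (sortK n W) i j))
    (hmm : ∀ (x y : Fin D → ℤ) (a b : F), W x y (Sum.inr a) (Sum.inr b) = 0)
    (hfm : ∀ (x y : Fin D → ℤ) (a b : F), W x y (Sum.inl a) (Sum.inr b) = W y x (Sum.inr b) (Sum.inl a)) :
    blocksHat p (sortK n W) = kkt (Matrix.of (periodiseF p (fTL (sortK n W)))) (Matrix.of (periodiseF p (fBL (sortK n W)))) := by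
  rw [kkt, blocksHat]
  congr 1
  · rw [fTR_sortK_eq_trF hfm, periodiseF_trF (fun a b => hper (Sum.inr a) (Sum.inl b))]
  · rw [fBR_sortK_eq_zero hmm, periodiseF_zero]

variable [Fintype F] [DecidableEq F]

/-- [folklore] **«KKT-SHAPE», SIGNED**: for a kernel `W` with jointly `p`-periodic sorted fibres, NO mm block and fm = MINUS the kernel-transpose of mf,
`blocksHat p (sortK n W) = kkt (Matrix.of (periodiseF p (fTL (sortK n W)))) (Matrix.of (periodiseF p (fBL (sortK n W)))) · fromBlocks 1 0 0 (−1)`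
— the shape of the SECOND-order dictionary letters `hJM″` (F-g6-1 placement) and of `TorusCombKKT.blocksHat_sortK_bhK`. -/
theorem blocksHat_sortK_eq_kkt_mul_sgn [NeZero n] (hper : ∀ i j, IsPeriodic₂ p (Kfib (sortK n W) i j))
    (hmm : ∀ (x y : Fin D → ℤ) (a b : F), W x y (Sum.inr a) (Sum.inr b) = 0)
    (hfm : ∀ (x y : Fin D → ℤ) (a b : F), W x y (Sum.inl a) (Sum.inr b) = -W y x (Sum.inr b) (Sum.inl a)) :
    blocksHat p (sortK n W)
      = kkt (Matrix.of (periodiseF p (fTL (sortK n W)))) (Matrix.of (periodiseF p (fBL (sortK n W))))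
          * Matrix.fromBlocks (1 : Matrix (Beta.Site D p × (TorusSite D n × F)) (Beta.Site D p × (TorusSite D n × F)) ℝ) 0 0
              (-1 : Matrix (Beta.Site D p × F) (Beta.Site D p × F) ℝ) := by
  rw [kkt, Matrix.fromBlocks_multiply]
  simp only [Matrix.mul_one, Matrix.mul_zero, add_zero, zero_add, Matrix.mul_neg, neg_zero]
  rw [blocksHat]
  congr 1
  · ext ⟨x, z, κ⟩ ⟨y, l⟩
    rw [Matrix.neg_apply, Matrix.transpose_apply, Matrix.of_apply, Matrix.of_apply, fTR_sortK_eq_neg_trF hfm, periodiseF_neg',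
      periodiseF_trF_apply (fun a b => hper (Sum.inr a) (Sum.inl b))]
  · rw [fBR_sortK_eq_zero hmm, periodiseF_zero]

end Shape

/-! ## §3 Parity read-outs of the ff block -/

section Parity

variable {W : MKer D (F ⊕ F)}

/-- [folklore] ff KERNEL SYMMETRY in sorted form: `trF (fTL (sortK n W)) = fTL (sortK n W)`. -/
theorem trF_fTL_sortK_eq (hff : ∀ (x y : Fin D → ℤ) (a b : F), W x y (Sum.inl a) (Sum.inl b) = W y x (Sum.inl b) (Sum.inl a)) :
    trF (fTL (sortK n W)) = fTL (sortK n W) := by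
  funext ⟨y, z, a⟩ ⟨y', z', b⟩
  rw [trF_apply]
  show sortK n W (y', Sum.inl (z', b)) (y, Sum.inl (z, a)) = sortK n W (y, Sum.inl (z, a)) (y', Sum.inl (z', b))
  rw [sortK_inl_inl, sortK_inl_inl]
  exact hff _ _ _ _

/-- [folklore] ff KERNEL ANTISYMMETRY in sorted form: `trF (fTL (sortK n W)) = −fTL (sortK n W)`. -/
theorem trF_fTL_sortK_eq_neg (hff : ∀ (x y : Fin D → ℤ) (a b : F), W x y (Sum.inl a) (Sum.inl b) = -W y x (Sum.inl b) (Sum.inl a)) :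
    trF (fTL (sortK n W)) = fun i j => -(fTL (sortK n W) i j) := by
  funext ⟨y, z, a⟩ ⟨y', z', b⟩
  rw [trF_apply]
  show sortK n W (y', Sum.inl (z', b)) (y, Sum.inl (z, a)) = -(sortK n W (y, Sum.inl (z, a)) (y', Sum.inl (z', b)))
  rw [sortK_inl_inl, sortK_inl_inl]
  exact hff _ _ _ _

/-- [folklore] **PARITY READ-OUT, SYMMETRIC**: a kernel-symmetric ff block periodises to a SYMMETRIC matrix — `(ff̂)ᵀ = ff̂` (the letter `hkₛₜ`, `hAₛₜ`-type). -/
theorem transpose_ffHat_eq [NeZero p] (hper : ∀ i j, IsPeriodic₂ p (Kfib (sortK n W) i j))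
    (hff : ∀ (x y : Fin D → ℤ) (a b : F), W x y (Sum.inl a) (Sum.inl b) = W y x (Sum.inl b) (Sum.inl a)) :
    (Matrix.of (periodiseF p (fTL (sortK n W))))ᵀ = Matrix.of (periodiseF p (fTL (sortK n W))) := by
  rw [← periodiseF_trF (fun a b => hper (Sum.inl a) (Sum.inl b)), trF_fTL_sortK_eq hff]

/-- [folklore] **PARITY READ-OUT, ANTISYMMETRIC**: a kernel-antisymmetric ff block periodises to an ANTISYMMETRIC matrix — `(ff̂)ᵀ = −ff̂` (the letters `hkₛ`, `hkₜ`). -/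
theorem transpose_ffHat_eq_neg [NeZero p] (hper : ∀ i j, IsPeriodic₂ p (Kfib (sortK n W) i j))
    (hff : ∀ (x y : Fin D → ℤ) (a b : F), W x y (Sum.inl a) (Sum.inl b) = -W y x (Sum.inl b) (Sum.inl a)) :
    (Matrix.of (periodiseF p (fTL (sortK n W))))ᵀ = -Matrix.of (periodiseF p (fTL (sortK n W))) := by
  rw [← periodiseF_trF (fun a b => hper (Sum.inl a) (Sum.inl b)), trF_fTL_sortK_eq_neg hff]
  ext ⟨x, z, a⟩ ⟨y, z', b⟩
  rw [Matrix.of_apply, Matrix.neg_apply, Matrix.of_apply, periodiseF_neg']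

end Parity

end Summit.QuantumFields.BalabanUV.Beta.D1BFx.SortedKKTShape

end
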